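import Summits.BirchSwinnertonDyer.BirchSwinnertonDyer.Theorems.SylvesterTwoHeegnerIndexYinIndex
import HarnessLib

/-!
# Route `SylvesterTwoHeegnerIndex` (rung K7t), LOWER cruxes 19891 `LowerOnV0HSY` / 19892 `LowerOffV0HSY`
# (and the UPPER residual of 19804): the `2`-DIVISIBILITY INDEX of the display point — engine and
# per-member dictionary in Yin's SINGLE-CURVE currency

Cell `bsd-cm`, seat `bsd-cm-k7t-c2` (prover-bsd-cm-k7t-c2-g9-0). PARTITION (D-0054): CornerF at
`p = 2` (B14/O12) × 𝒞_HSY (`E_p : x³ + y³ = p`, `p ≡ 4, 7 (mod 9)`) × `p = 2` — types-the-object-of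
(kernel helper `--supports stmt-BirchSwinnertonDyer-19892`); closes no cell and no item; BSD is not
claimed. Everything here is PROVED: no definition, no named fact, no `sorry`.

WHY. The planner's skeletons of record for the LOWER children (19891 `lowerOnV0_residueSplit`
970655c0d892bd70, 19892 `lowerOffV0_residueSplit` 405a698bbca207af) say: «the 7-mod-9 stub is the one a
Yin-currency argument can reach first (… may re-type it in that currency; the planner re-registers)».
bsd-cm-two g8's `…YinIndex.lean` did this for the UPPER side with the `j = 1` engine
`SylvesterTwoNonneg.twoDivisible_iff_add_two_le_padicValRat_of_model` («`Y ∈ 2·B(K) + tors ⟺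
i + 2 ≤ ord₂ q`»). The LOWER side needs ALL powers of `2`. This file is that engine and the per-member
dictionary; the class-level re-typing (crux decls by name, both directions) is the companion file
`…YinLower.lean`.

* §1 (engine currency: a model `B/ℚ` of `E_p`, `p` an odd prime, `K ∋ ω` quadratic,
  `rank_ℤ B(K) = 2`, a rational generator `P₀` in `ι`-form, `Y ∈ B(K)`, `q ≠ 0` rational with
  `q·ĥ_K(ι P₀) = 2^i·ĥ_K(Y)`):
  **`powDivisible_iff_le_padicValRat_of_model`** — for every `j : ℕ`,
  `Y ∈ 2^j·B(K) + tors ⟺ i + 2j ≤ ord₂ q` (induction on `j` over bsd-cm-two's `j = 1` engine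
  p464849 / p444380); and **`exists_divisibilityIndex_of_model`** — for `i` even there is a UNIQUE-shaped
  `j : ℕ` with `ord₂ q = i + 2j`, `Y ∈ 2^j·B(K) + tors`, `Y ∉ 2^{j+1}·B(K) + tors` (parity: x1b's
  `even_padicValRat_two_of_model`, `2` inert in `ℤ[ω]`; range: two's `le_padicValRat_two_of_model`,
  the rational generator is not halvable). So `ord₂ q` IS the `2`-divisibility index of `Y` modulo
  torsion, doubled and shifted by `i`.
* §2 (per member, a display datum `(u·qB)·ĥ_K(ι P₀) = 2^{2δ}·ĥ_K(Y)` with `#Ш_an(B) = qB`, `u` a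
  `2`-adic unit, `2δ ∈ {0, −2}` — Yin's display position, or Hu–Shu–Yin's with the twin absorbed):
  **`missingLowerBoundAt_two_iff_forall_powDivisible_le`** — `MissingLowerBoundAt B 2 ⟺ (∀ j,
  Y ∈ 2^j·B(K) + tors → 2j + 2δ ≤ ord₂ #Ш(B))`: the main-conjecture half of `BSD(E_p, 2)` IS an UPPER
  bound on the `2`-divisibility of ONE point; **`missingUpperBoundAt_two_iff_exists_powDivisible_ge`**
  — `MissingUpperBoundAt B 2 ⟺ (∃ j, Y ∈ 2^j·B(K) + tors ∧ ord₂ #Ш(B) ≤ 2j + 2δ)`: the Euler-system half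
  IS a LOWER bound on it; and **`missingPPartAt_two_iff_exists_exactIndex`** — `BSD(E_p,2)`'s last
  clause ⟺ the index is EXACTLY `ord₂ #Ш(B)/2 − δ` (memo two Thm B (iii), single curve, kernel form).

HONEST READING. Nothing here proves either half for any `p`. The file turns the two open halves of
`BSD(E_p, 2)` on 𝒞_HSY into two inequalities on ONE integer per `p` — the `2`-divisibility index of
Yin's point `Z_p` (arXiv:2607.01744, PREPRINT display) in `E_p(ℚ(√−3))/tors ≅ ℤ[ω]` — with the twin
`E_{3p²}` gone. LOWER = «`Z_p` is NOT too divisible» (no mechanism in print at the inert prime `2`: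
Kolyvagin-conjecture direction; memo two §22.3); UPPER = «`Z_p` IS divisible enough» (C′ is its first
bit on `p ≡ 7 (9)`).

## References
* H. Yin, arXiv:2607.01744 (2026), Thm. 1.1, (3.5.3), p. 12 (PREPRINT display shape `YinHeightDisplay`).
* Y. Hu, J. Shu, H. Yin, Trans. AMS 372 (2019) = arXiv:1708.05266, pp. 8, 12.
* R. L. Miller, LMS J. Comput. Math. 14 (2011), Def. 1.1 (`MissingLower/UpperBoundAt`, `MissingPPartAt`).
* J. H. Silverman, *The Arithmetic of Elliptic Curves*, GTM 106, VIII.9.3 (heights), X.1 (descent).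
* MEMO bsd-cm-two v2.11 §15.2 Thm B, §22.1–22.3, §46–§47; parents p444380, p464849, p478097 (`…YinIndex`).
-/

set_option autoImplicit false
-- the Summit-side namespace `Summit.BirchSwinnertonDyer.BirchSwinnertonDyer.…` (summit = problem) is mandated by D-0017
set_option linter.dupNamespace false

noncomputable section

open scoped Classical

open WeierstrassCurve WeierstrassCurve.Affine WeierstrassCurve.Affine.Point
  Summit.BirchSwinnertonDyer.BirchSwinnertonDyer.Theorems.SylvesterTwoCMNormForm
  Summit.BirchSwinnertonDyer.BirchSwinnertonDyer.Theorems.SylvesterTwoNonneg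
  Literature.NumberTheory.EllipticCurves Literature.NumberTheory.EllipticCurves.HuShuYin2019
  Literature.NumberTheory.EllipticCurves.Rank1Residual.Typed

namespace Summit.BirchSwinnertonDyer.BirchSwinnertonDyer.Theorems.SylvesterTwoYinLower

/-! ## §0 Bookkeeping on powers of `2` -/

/-- `ĥ(2^j·Y′ + T′) = 2^{2j}·ĥ(Y′)` for `T′` torsion, written with the exponent `i + 2j` the engine
uses: `2^i·ĥ(2^j Y′ + T′) = 2^{i+2j}·ĥ(Y′)`. [cite: SilvermanAEC2009, Thm. VIII.9.3(b) and (d)] -/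
theorem two_zpow_mul_canonicalHeight_pow_smul_add {K : Type} [Field K] [NumberField K]
    {W : WeierstrassCurve K} [W.IsElliptic] (Y' T' : W.toAffine.Point) (hT' : IsOfFinAddOrder T')
    (i : ℤ) (j : ℕ) :
    (2 : ℝ) ^ i * canonicalHeight (((2 : ℤ) ^ j) • Y' + T') =
      (2 : ℝ) ^ (i + 2 * (j : ℤ)) * canonicalHeight Y' := by
  have key : (2 : ℝ) ^ (i + 2 * (j : ℤ)) = (2 : ℝ) ^ i * ((2 : ℝ) ^ j) ^ 2 := by
    rw [zpow_add₀ two_ne_zero, show (2 : ℤ) * (j : ℤ) = ((2 * j : ℕ) : ℤ) by push_cast; ring,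
      zpow_natCast, pow_mul']
  rw [canonicalHeight_add_of_isOfFinAddOrder _ T' hT', canonicalHeight_zsmul_holds, key]
  push_cast
  ring

/-- `2^{j+1}·Y = 2·(2^j·Y)`. [folklore] -/
theorem two_pow_succ_smul {A : Type*} [AddCommGroup A] (j : ℕ) (Y : A) :
    ((2 : ℤ) ^ (j + 1)) • Y = (2 : ℤ) • (((2 : ℤ) ^ j) • Y) := by
  rw [smul_smul, pow_succ']

/-! ## §1 Engine: `Y ∈ 2^j·B(K) + tors ⟺ i + 2j ≤ ord₂ q` on a model of `E_p` -/

section Model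

variable {K : Type} [Field K] [NumberField K] {ω : K}

/-- **`2^j`-DIVISIBLE ⟹ `i + 2j ≤ ord₂ q`.** `K/ℚ` quadratic with `ω ∈ K` (`ω² + ω + 1 = 0`), `B/ℚ` a
model of `E_p` (`C • B = cubeSumCurve p`, `p` an odd prime) with `rank_ℤ B(K) = 2`, `P₀ ∈ B(ℚ)` a
generator modulo torsion in `ι`-form with `ι P₀` of infinite order, `Y ∈ B(K)`, `q ≠ 0` rational with
`q·ĥ_K(ι P₀) = 2^i·ĥ_K(Y)`. If `Y = 2^j·Y′ + T′` with `T′` torsion then `q·ĥ_K(ι P₀) = 2^{i+2j}·ĥ_K(Y′)`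
and bsd-cm-two's `le_padicValRat_two_of_model` (the rational generator is not halvable) gives
`i + 2j ≤ ord₂ q`. The case `j = 1` is p444380's `add_two_le_padicValRat_two_of_model_of_twoDivisible`.
[cite: HuShuYin2019, pp. 8, 12] [cite: SilvermanAEC2009, Thm. VIII.9.3(b)] -/
theorem le_padicValRat_two_of_model_of_powDivisible (hω : ω ^ 2 + ω + 1 = 0)
    (h2K : Module.finrank ℚ K = 2) {p : ℕ} (hp : p.Prime) (hp2 : p ≠ 2) (B : WeierstrassCurve ℚ)
    [B.IsElliptic] (C : VariableChange ℚ) (hC : C • B = cubeSumCurve (p : ℚ))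
    (hrank : (B.baseChange K).mordellWeilRank = 2) (P₀ : B.toAffine.Point)
    (hP : ¬ IsOfFinAddOrder (QuadraticDescent.incl K B P₀))
    (hgen : ∀ Q : B.toAffine.Point, ∃ m : ℤ,
      IsOfFinAddOrder (QuadraticDescent.incl K B Q - m • QuadraticDescent.incl K B P₀))
    {Y : (B.baseChange K).toAffine.Point} {q : ℚ} (hq : q ≠ 0) {i : ℤ}
    (hid : (q : ℝ) * canonicalHeight (QuadraticDescent.incl K B P₀) = (2 : ℝ) ^ i * canonicalHeight Y)
    {j : ℕ} (hdiv : ∃ Y' T' : (B.baseChange K).toAffine.Point,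
      IsOfFinAddOrder T' ∧ Y = ((2 : ℤ) ^ j) • Y' + T') :
    i + 2 * (j : ℤ) ≤ padicValRat 2 q := by
  obtain ⟨Y', T', hT', rfl⟩ := hdiv
  haveI hBK : (B.baseChange K).IsElliptic := inferInstanceAs (B.map (algebraMap ℚ K)).IsElliptic
  have hid' : (q : ℝ) * canonicalHeight (QuadraticDescent.incl K B P₀) =
      (2 : ℝ) ^ (i + 2 * (j : ℤ)) * canonicalHeight Y' := by
    rw [hid, two_zpow_mul_canonicalHeight_pow_smul_add Y' T' hT' i j]
  exact le_padicValRat_two_of_model hω h2K hp hp2 B C hC hrank P₀ hP hgen Y' hq hid'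

/-- **`i + 2j ≤ ord₂ q` ⟹ `2^j`-DIVISIBLE** (same setting): if `i + 2j ≤ ord₂ q` then
`Y = 2^j·Y′ + T′` with `T′` torsion. Induction on `j`: the step is bsd-cm-two's `2`-divisibility descent
`exists_eq_two_smul_add_torsion_of_model_of_le_padicValRat` (p464849: `i + 2 ≤ ord₂ q ⇒ Y = 2Y₁ + T₁`)
applied to `Y`, then the induction hypothesis applied to `Y₁` in display position `i + 2`.
[cite: HuShuYin2019, pp. 8, 12] [cite: SilvermanAEC2009, X.1] -/
theorem exists_eq_pow_smul_add_torsion_of_model_of_le_padicValRat (hω : ω ^ 2 + ω + 1 = 0)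
    (h2K : Module.finrank ℚ K = 2) {p : ℕ} (hp : p.Prime) (hp2 : p ≠ 2) (B : WeierstrassCurve ℚ)
    [B.IsElliptic] (C : VariableChange ℚ) (hC : C • B = cubeSumCurve (p : ℚ))
    (hrank : (B.baseChange K).mordellWeilRank = 2) (P₀ : B.toAffine.Point)
    (hP : ¬ IsOfFinAddOrder (QuadraticDescent.incl K B P₀))
    (hgen : ∀ Q : B.toAffine.Point, ∃ m : ℤ,
      IsOfFinAddOrder (QuadraticDescent.incl K B Q - m • QuadraticDescent.incl K B P₀))
    {q : ℚ} (hq : q ≠ 0) :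
    ∀ (j : ℕ) (Y : (B.baseChange K).toAffine.Point) (i : ℤ),
      (q : ℝ) * canonicalHeight (QuadraticDescent.incl K B P₀) = (2 : ℝ) ^ i * canonicalHeight Y →
      i + 2 * (j : ℤ) ≤ padicValRat 2 q →
      ∃ Y' T' : (B.baseChange K).toAffine.Point, IsOfFinAddOrder T' ∧ Y = ((2 : ℤ) ^ j) • Y' + T' := by
  haveI hBK : (B.baseChange K).IsElliptic := inferInstanceAs (B.map (algebraMap ℚ K)).IsElliptic
  intro j
  induction j with
  | zero =>
    intro Y i _ _
    exact ⟨Y, 0, IsOfFinAddOrder.zero, by simp⟩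
  | succ j ih =>
    intro Y i hid hv
    have hv1 : i + 2 ≤ padicValRat 2 q := by push_cast at hv; linarith
    obtain ⟨Y₁, T₁, hT₁, hY₁⟩ := exists_eq_two_smul_add_torsion_of_model_of_le_padicValRat hω h2K hp
      hp2 B C hC hrank P₀ hP hgen Y hq hid hv1
    have hid₁ : (q : ℝ) * canonicalHeight (QuadraticDescent.incl K B P₀) =
        (2 : ℝ) ^ (i + 2) * canonicalHeight Y₁ := by
      have h := two_zpow_mul_canonicalHeight_pow_smul_add Y₁ T₁ hT₁ i 1
      rw [pow_one] at h
      rw [hid, hY₁, h]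
      norm_num
    have hv' : (i + 2) + 2 * (j : ℤ) ≤ padicValRat 2 q := by push_cast at hv; linarith
    obtain ⟨Y₂, T₂, hT₂, hY₂⟩ := ih Y₁ (i + 2) hid₁ hv'
    refine ⟨Y₂, (2 : ℤ) • T₂ + T₁, hT₂.zsmul.add hT₁, ?_⟩
    rw [hY₁, hY₂, smul_add, two_pow_succ_smul]
    abel

/-- **`Y ∈ 2^j·B(K) + tors ⟺ i + 2j ≤ ord₂ q`** (same setting), for every `j : ℕ` — the `2`-power
generalisation of bsd-cm-two's `twoDivisible_iff_add_two_le_padicValRat_of_model` (`j = 1`).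
[cite: HuShuYin2019, pp. 8, 12] -/
theorem powDivisible_iff_le_padicValRat_of_model (hω : ω ^ 2 + ω + 1 = 0)
    (h2K : Module.finrank ℚ K = 2) {p : ℕ} (hp : p.Prime) (hp2 : p ≠ 2) (B : WeierstrassCurve ℚ)
    [B.IsElliptic] (C : VariableChange ℚ) (hC : C • B = cubeSumCurve (p : ℚ))
    (hrank : (B.baseChange K).mordellWeilRank = 2) (P₀ : B.toAffine.Point)
    (hP : ¬ IsOfFinAddOrder (QuadraticDescent.incl K B P₀))
    (hgen : ∀ Q : B.toAffine.Point, ∃ m : ℤ,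
      IsOfFinAddOrder (QuadraticDescent.incl K B Q - m • QuadraticDescent.incl K B P₀))
    (Y : (B.baseChange K).toAffine.Point) {q : ℚ} (hq : q ≠ 0) {i : ℤ}
    (hid : (q : ℝ) * canonicalHeight (QuadraticDescent.incl K B P₀) = (2 : ℝ) ^ i * canonicalHeight Y)
    (j : ℕ) :
    (∃ Y' T' : (B.baseChange K).toAffine.Point, IsOfFinAddOrder T' ∧ Y = ((2 : ℤ) ^ j) • Y' + T') ↔
      i + 2 * (j : ℤ) ≤ padicValRat 2 q :=
  ⟨fun h => le_padicValRat_two_of_model_of_powDivisible hω h2K hp hp2 B C hC hrank P₀ hP hgen hq hid h,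
    exists_eq_pow_smul_add_torsion_of_model_of_le_padicValRat hω h2K hp hp2 B C hC hrank P₀ hP hgen hq
      j Y i hid⟩

/-- **THE `2`-DIVISIBILITY INDEX** (same setting, `i` even): there is `j : ℕ` with
`ord₂ q = i + 2j`, `Y ∈ 2^j·B(K) + tors` and `Y ∉ 2^{j+1}·B(K) + tors` — i.e. `ord₂ q` is `i` plus
TWICE the `2`-divisibility index of `Y` modulo torsion. Parity from x1b's
`even_padicValRat_two_of_model` (`2` is inert in `ℤ[ω]`), range from bsd-cm-two's
`le_padicValRat_two_of_model`, the two clauses from §1. [cite: HuShuYin2019, pp. 8, 12] -/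
theorem exists_divisibilityIndex_of_model (hω : ω ^ 2 + ω + 1 = 0)
    (h2K : Module.finrank ℚ K = 2) {p : ℕ} (hp : p.Prime) (hp2 : p ≠ 2) (B : WeierstrassCurve ℚ)
    [B.IsElliptic] (C : VariableChange ℚ) (hC : C • B = cubeSumCurve (p : ℚ))
    (hrank : (B.baseChange K).mordellWeilRank = 2) (P₀ : B.toAffine.Point)
    (hP : ¬ IsOfFinAddOrder (QuadraticDescent.incl K B P₀))
    (hgen : ∀ Q : B.toAffine.Point, ∃ m : ℤ,
      IsOfFinAddOrder (QuadraticDescent.incl K B Q - m • QuadraticDescent.incl K B P₀))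
    (Y : (B.baseChange K).toAffine.Point) {q : ℚ} (hq : q ≠ 0) {i : ℤ} (hi : Even i)
    (hid : (q : ℝ) * canonicalHeight (QuadraticDescent.incl K B P₀) = (2 : ℝ) ^ i * canonicalHeight Y) :
    ∃ j : ℕ, padicValRat 2 q = i + 2 * (j : ℤ) ∧
      (∃ Y' T' : (B.baseChange K).toAffine.Point, IsOfFinAddOrder T' ∧ Y = ((2 : ℤ) ^ j) • Y' + T') ∧
      ¬ (∃ Y' T' : (B.baseChange K).toAffine.Point,
        IsOfFinAddOrder T' ∧ Y = ((2 : ℤ) ^ (j + 1)) • Y' + T') := by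
  have hpar := even_padicValRat_two_of_model hω B C hC hrank hP Y hq hi hid
  have hle := le_padicValRat_two_of_model hω h2K hp hp2 B C hC hrank P₀ hP hgen Y hq hid
  obtain ⟨a, ha⟩ := hpar
  obtain ⟨b, hb⟩ := hi
  obtain ⟨j, hj⟩ : ∃ j : ℕ, padicValRat 2 q = i + 2 * (j : ℤ) := by
    refine ⟨(a - b).toNat, ?_⟩
    have h0 : 0 ≤ a - b := by omega
    rw [Int.toNat_of_nonneg h0]; omega
  refine ⟨j, hj, ?_, ?_⟩
  · exact (powDivisible_iff_le_padicValRat_of_model hω h2K hp hp2 B C hC hrank P₀ hP hgen Y hq hid j).mpr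
      (by rw [hj])
  · intro h
    have := (powDivisible_iff_le_padicValRat_of_model hω h2K hp hp2 B C hC hrank P₀ hP hgen Y hq hid
      (j + 1)).mp h
    push_cast at this
    omega

end Model

/-! ## §2 Per member: the two halves of `BSD(E_p, 2)` as inequalities on the index of ONE point -/

section Datum

variable {K : Type} [Field K] [NumberField K] {ω : K}

/-- **MAIN-CONJECTURE HALF ⟺ UPPER BOUND ON THE DIVISIBILITY INDEX.** A DISPLAY DATUM for a model
`B` of `E_p` (`p` an odd prime): `#Ш_an(B) = qB ≠ 0`, `K ∋ ω` quadratic with `rank_ℤ B(K) = 2`, a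
rational generator `P₀` (`ι`-form), `Y ∈ B(K)`, a `2`-adic unit `u` and an EVEN exponent `e` with
`(u·qB)·ĥ_K(ι P₀) = 2^e·ĥ_K(Y)` (Yin's position: `e = 0 | −2` for `p ≡ 4 | 7 (9)`). Then
`MissingLowerBoundAt B 2` (`ord₂ #Ш_an(B) ≤ ord₂ #Ш(B)`, Miller) holds IFF every power `2^j` dividing
`Y` modulo torsion satisfies `2j + e ≤ ord₂ #Ш(B)` — the LOWER half of `BSD(E_p, 2)` is the statement
that ONE explicit point is NOT TOO `2`-DIVISIBLE over `ℚ(√−3)`. (`#Ш(B)` in Miller's `shaOrder`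
currency: `0`-valued junk if `Ш(B)` were infinite — no finiteness is used here.)
[cite: Miller2011LMS, Def. 1.1] [cite: HuShuYin2019, pp. 8, 12] -/
theorem missingLowerBoundAt_two_iff_forall_powDivisible_le (hω : ω ^ 2 + ω + 1 = 0)
    (h2K : Module.finrank ℚ K = 2) {p : ℕ} (hp : p.Prime) (hp2 : p ≠ 2) (B : WeierstrassCurve ℚ)
    [B.IsElliptic] (hB : ∃ C : VariableChange ℚ, C • B = cubeSumCurve (p : ℚ))
    {qB : ℚ} (hqB : shaAn B = (qB : ℂ)) (hq0 : qB ≠ 0)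
    (hrank : (B.baseChange K).mordellWeilRank = 2) (P₀ : B.toAffine.Point)
    (hP : ¬ IsOfFinAddOrder (QuadraticDescent.incl K B P₀))
    (hgen : ∀ Q : B.toAffine.Point, ∃ m : ℤ,
      IsOfFinAddOrder (QuadraticDescent.incl K B Q - m • QuadraticDescent.incl K B P₀))
    (Y : (B.baseChange K).toAffine.Point) {u : ℚ} (hu0 : u ≠ 0) (hu : padicValRat 2 u = 0)
    {e : ℤ} (he : Even e)
    (hid : ((u * qB : ℚ) : ℝ) * canonicalHeight (QuadraticDescent.incl K B P₀) =
      (2 : ℝ) ^ e * canonicalHeight Y) :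
    MissingLowerBoundAt B 2 ↔
      ∀ j : ℕ, (∃ Y' T' : (B.baseChange K).toAffine.Point,
          IsOfFinAddOrder T' ∧ Y = ((2 : ℤ) ^ j) • Y' + T') →
        2 * (j : ℤ) + e ≤ (padicValNat 2 B.shaOrder : ℤ) := by
  obtain ⟨C, hC⟩ := hB
  have huq : u * qB ≠ 0 := mul_ne_zero hu0 hq0
  have hval : padicValRat 2 (u * qB) = padicValRat 2 qB :=
    SylvesterTwoYin.padicValRat_two_unit_mul hu0 hq0 hu
  constructor
  · rintro ⟨q, hq, hle⟩ j hdiv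
    have e1 : q = qB := by exact_mod_cast hq.symm.trans hqB
    subst e1
    have h := le_padicValRat_two_of_model_of_powDivisible hω h2K hp hp2 B C hC hrank P₀ hP hgen huq
      hid hdiv
    rw [hval] at h
    linarith
  · intro h
    obtain ⟨j, hj, hdiv, -⟩ := exists_divisibilityIndex_of_model hω h2K hp hp2 B C hC hrank P₀ hP hgen
      Y huq he hid
    refine ⟨qB, hqB, ?_⟩
    have hb := h j hdiv
    rw [← hval, hj]
    linarith

/-- **EULER-SYSTEM HALF ⟺ LOWER BOUND ON THE DIVISIBILITY INDEX** (same datum):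
`MissingUpperBoundAt B 2` (`ord₂ #Ш(B) ≤ ord₂ #Ш_an(B)`) holds IFF `Y ∈ 2^j·B(K) + tors` for SOME `j`
with `ord₂ #Ш(B) ≤ 2j + e` — ONE explicit point IS `2`-divisible ENOUGH. (For `e = −2` and
`ord₂ #Ш(B) = 0` this is `j ≥ 1`: CONJECTURE C′, bsd-cm-two's `…YinIndex` §5.)
[cite: Miller2011LMS, Def. 1.1] [cite: HuShuYin2019, pp. 8, 12] -/
theorem missingUpperBoundAt_two_iff_exists_powDivisible_ge (hω : ω ^ 2 + ω + 1 = 0)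
    (h2K : Module.finrank ℚ K = 2) {p : ℕ} (hp : p.Prime) (hp2 : p ≠ 2) (B : WeierstrassCurve ℚ)
    [B.IsElliptic] (hB : ∃ C : VariableChange ℚ, C • B = cubeSumCurve (p : ℚ))
    {qB : ℚ} (hqB : shaAn B = (qB : ℂ)) (hq0 : qB ≠ 0)
    (hrank : (B.baseChange K).mordellWeilRank = 2) (P₀ : B.toAffine.Point)
    (hP : ¬ IsOfFinAddOrder (QuadraticDescent.incl K B P₀))
    (hgen : ∀ Q : B.toAffine.Point, ∃ m : ℤ,
      IsOfFinAddOrder (QuadraticDescent.incl K B Q - m • QuadraticDescent.incl K B P₀))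
    (Y : (B.baseChange K).toAffine.Point) {u : ℚ} (hu0 : u ≠ 0) (hu : padicValRat 2 u = 0)
    {e : ℤ} (he : Even e)
    (hid : ((u * qB : ℚ) : ℝ) * canonicalHeight (QuadraticDescent.incl K B P₀) =
      (2 : ℝ) ^ e * canonicalHeight Y) :
    MissingUpperBoundAt B 2 ↔
      ∃ j : ℕ, (∃ Y' T' : (B.baseChange K).toAffine.Point,
          IsOfFinAddOrder T' ∧ Y = ((2 : ℤ) ^ j) • Y' + T') ∧
        (padicValNat 2 B.shaOrder : ℤ) ≤ 2 * (j : ℤ) + e := by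
  obtain ⟨C, hC⟩ := hB
  have huq : u * qB ≠ 0 := mul_ne_zero hu0 hq0
  have hval : padicValRat 2 (u * qB) = padicValRat 2 qB :=
    SylvesterTwoYin.padicValRat_two_unit_mul hu0 hq0 hu
  constructor
  · rintro ⟨q, hq, hle⟩
    have e1 : q = qB := by exact_mod_cast hq.symm.trans hqB
    subst e1
    obtain ⟨j, hj, hdiv, -⟩ := exists_divisibilityIndex_of_model hω h2K hp hp2 B C hC hrank P₀ hP hgen
      Y huq he hid
    refine ⟨j, hdiv, ?_⟩
    rw [← hval, hj] at hle
    linarith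
  · rintro ⟨j, hdiv, hle⟩
    refine ⟨qB, hqB, ?_⟩
    have h := le_padicValRat_two_of_model_of_powDivisible hω h2K hp hp2 B C hC hrank P₀ hP hgen huq
      hid hdiv
    rw [hval] at h
    linarith

/-- **`BSD(E_p, 2)`'S LAST CLAUSE ⟺ EXACT DIVISIBILITY INDEX** (same datum): `MissingPPartAt B 2`
(`ord₂ #Ш_an(B) = ord₂ #Ш(B)`) holds IFF for some `j : ℕ`, `Y ∈ 2^j·B(K) + tors`,
`Y ∉ 2^{j+1}·B(K) + tors` and `2j + e = ord₂ #Ш(B)` — memo two Thm B (iii) in single-curve kernel form: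
the unknown of 𝒞_HSY at `2` is ONE non-negative integer per `p`, and `BSD(E_p, 2)` pins it to
`ord₂ #Ш(E_p)/2 − e/2`. [cite: Miller2011LMS, Def. 1.1] [cite: HuShuYin2019, pp. 8, 12] -/
theorem missingPPartAt_two_iff_exists_exactIndex (hω : ω ^ 2 + ω + 1 = 0)
    (h2K : Module.finrank ℚ K = 2) {p : ℕ} (hp : p.Prime) (hp2 : p ≠ 2) (B : WeierstrassCurve ℚ)
    [B.IsElliptic] (hB : ∃ C : VariableChange ℚ, C • B = cubeSumCurve (p : ℚ))
    {qB : ℚ} (hqB : shaAn B = (qB : ℂ)) (hq0 : qB ≠ 0)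
    (hrank : (B.baseChange K).mordellWeilRank = 2) (P₀ : B.toAffine.Point)
    (hP : ¬ IsOfFinAddOrder (QuadraticDescent.incl K B P₀))
    (hgen : ∀ Q : B.toAffine.Point, ∃ m : ℤ,
      IsOfFinAddOrder (QuadraticDescent.incl K B Q - m • QuadraticDescent.incl K B P₀))
    (Y : (B.baseChange K).toAffine.Point) {u : ℚ} (hu0 : u ≠ 0) (hu : padicValRat 2 u = 0)
    {e : ℤ} (he : Even e)
    (hid : ((u * qB : ℚ) : ℝ) * canonicalHeight (QuadraticDescent.incl K B P₀) =
      (2 : ℝ) ^ e * canonicalHeight Y) :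
    MissingPPartAt B 2 ↔
      ∃ j : ℕ, (∃ Y' T' : (B.baseChange K).toAffine.Point,
          IsOfFinAddOrder T' ∧ Y = ((2 : ℤ) ^ j) • Y' + T') ∧
        ¬ (∃ Y' T' : (B.baseChange K).toAffine.Point,
          IsOfFinAddOrder T' ∧ Y = ((2 : ℤ) ^ (j + 1)) • Y' + T') ∧
        2 * (j : ℤ) + e = (padicValNat 2 B.shaOrder : ℤ) := by
  obtain ⟨C, hC⟩ := hB
  have huq : u * qB ≠ 0 := mul_ne_zero hu0 hq0
  have hval : padicValRat 2 (u * qB) = padicValRat 2 qB :=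
    SylvesterTwoYin.padicValRat_two_unit_mul hu0 hq0 hu
  obtain ⟨j, hj, hdiv, hndiv⟩ := exists_divisibilityIndex_of_model hω h2K hp hp2 B C hC hrank P₀ hP
    hgen Y huq he hid
  rw [hval] at hj
  constructor
  · rintro ⟨q, hq, hv⟩
    have e1 : q = qB := by exact_mod_cast hq.symm.trans hqB
    subst e1
    exact ⟨j, hdiv, hndiv, by rw [← hv, hj]; ring⟩
  · rintro ⟨j', hdiv', hndiv', hj'⟩
    -- the index is unique: `j' = j`
    have hle : e + 2 * (j' : ℤ) ≤ padicValRat 2 (u * qB) :=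
      le_padicValRat_two_of_model_of_powDivisible hω h2K hp hp2 B C hC hrank P₀ hP hgen huq hid hdiv'
    have hlt : ¬ e + 2 * ((j' : ℤ) + 1) ≤ padicValRat 2 (u * qB) := fun h =>
      hndiv' ((powDivisible_iff_le_padicValRat_of_model hω h2K hp hp2 B C hC hrank P₀ hP hgen Y huq hid
        (j' + 1)).mpr (by push_cast; linarith))
    refine ⟨qB, hqB, ?_⟩
    rw [hval] at hle hlt
    rw [hj] at hle hlt ⊢
    rw [← hj']
    omega

end Datum

end Summit.BirchSwinnertonDyer.BirchSwinnertonDyer.Theorems.SylvesterTwoYinLower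

end
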